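/-
HONEST FRAMING: exact (Metropolis-corrected) sampling algorithms for lattice gauge theory; figures of merit
are autocorrelation/cost numbers at stated couplings and volumes; no continuum-physics claim.
-/
import Mathlib
import Summits.Ventures.LatticeQCDFlow.TrivializingMaps.WilsonGradientBound
import Summits.Ventures.LatticeQCDFlow.TrivializingMaps.MassTransferContraction

/-!
# The plaquette link complex of the periodic lattice (THEORY-1 §19, step (6c), part 1)

Venture-side (`Summits/Ventures/LatticeQCDFlow/`), never `Literature/`.  The incidence structure
`LinkComplex` of the tree's `MassTransferContraction`, instantiated for the Wilson plaquettes of `(ℤ/L)^d`: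
plaquette label `p = (x, μ, ν)` has the links `plaqIdx x μ ν s` (`s < 4`; `plaqLinks`), at most four of them,
and at most `D = 4d²` plaquette labels pass through any link — UNIFORMLY IN THE VOLUME `L` (for a fixed
slot the label is determined by its two directions, `plaq_injOn`).  0 sorry. [folklore]
-/

namespace Summit.Ventures.LatticeQCDFlow.TrivializingMaps.GradedSeries

open Finset
open Literature.MathematicalPhysics.QuantumFieldTheory
open MassTransfer

variable {d L : ℕ} [NeZero L]

/-! ## The plaquette link complex -/

section Complex
variable (d L)

/-- The links of the plaquette label `p = (x, μ, ν)`. [folklore] -/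
def plaqLinks (p : Site d L × Fin d × Fin d) : Finset (Edge d L) :=
  Finset.univ.image (plaqIdx p.1 p.2.1 p.2.2)

variable {d L}

omit [NeZero L] in
/-- Membership in `plaqLinks`. [folklore] -/
theorem mem_plaqLinks {p : Site d L × Fin d × Fin d} {e : Edge d L} :
    e ∈ plaqLinks d L p ↔ ∃ s, plaqIdx p.1 p.2.1 p.2.2 s = e := by
  simp [plaqLinks]

omit [NeZero L] in
/-- Non-membership in `plaqLinks`. [folklore] -/
theorem not_mem_plaqLinks {p : Site d L × Fin d × Fin d} {e : Edge d L} :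
    e ∉ plaqLinks d L p ↔ ∀ s, plaqIdx p.1 p.2.1 p.2.2 s ≠ e := by
  simp [mem_plaqLinks]

omit [NeZero L] in
/-- A plaquette has at most four links. [folklore] -/
theorem card_plaqLinks_le (p : Site d L × Fin d × Fin d) : (plaqLinks d L p).card ≤ 4 :=
  Finset.card_image_le.trans (by simp)

omit [NeZero L] in
/-- Slot 0 of `plaqIdx`. [folklore] -/
@[simp] theorem plaqIdx_zero (x : Site d L) (μ ν : Fin d) : plaqIdx x μ ν 0 = (x, μ) := rfl

omit [NeZero L] in
/-- Slot 1 of `plaqIdx`. [folklore] -/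
@[simp] theorem plaqIdx_one (x : Site d L) (μ ν : Fin d) : plaqIdx x μ ν 1 = (x.shift μ, ν) := rfl

omit [NeZero L] in
/-- Slot 2 of `plaqIdx`. [folklore] -/
@[simp] theorem plaqIdx_two (x : Site d L) (μ ν : Fin d) : plaqIdx x μ ν 2 = (x.shift ν, μ) := rfl

omit [NeZero L] in
/-- Slot 3 of `plaqIdx`. [folklore] -/
@[simp] theorem plaqIdx_three (x : Site d L) (μ ν : Fin d) : plaqIdx x μ ν 3 = (x, ν) := rfl

omit [NeZero L] in
/-- For a fixed slot, the plaquette label through a link is determined by its two directions. [folklore] -/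
theorem plaq_injOn (e : Edge d L) (s : Fin 4) :
    Set.InjOn (fun p : Site d L × Fin d × Fin d => p.2) {p | plaqIdx p.1 p.2.1 p.2.2 s = e} := by
  intro p hp p' hp' hf
  simp only [Set.mem_setOf_eq] at hp hp'
  have h := hp.trans hp'.symm
  obtain ⟨x, μ, ν⟩ := p
  obtain ⟨x', μ', ν'⟩ := p'
  simp only at hf h ⊢
  obtain ⟨rfl, rfl⟩ := Prod.mk.inj hf
  suffices hx : x = x' by rw [hx]
  revert h
  match s with
  | 0 => intro h; simpa using h
  | 1 => intro h; simpa [Site.shift] using h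
  | 2 => intro h; simpa [Site.shift] using h
  | 3 => intro h; simpa using h

/-- At most `d²` plaquette labels have the link `e` in a given slot. [folklore] -/
theorem card_filter_slot_le (e : Edge d L) (s : Fin 4) :
    (Finset.univ.filter fun p : Site d L × Fin d × Fin d => plaqIdx p.1 p.2.1 p.2.2 s = e).card ≤ d * d := by
  have h := Finset.card_le_card_of_injOn (s := Finset.univ.filter fun p : Site d L × Fin d × Fin d =>
      plaqIdx p.1 p.2.1 p.2.2 s = e) (t := (Finset.univ : Finset (Fin d × Fin d)))
    (fun p : Site d L × Fin d × Fin d => p.2) (fun p _ => Finset.mem_coe.2 (Finset.mem_univ _))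
    (by
      have h1 := plaq_injOn e s
      intro p hp p' hp' hf
      simp only [Finset.coe_filter, Finset.mem_univ, true_and, Set.mem_setOf_eq] at hp hp'
      exact h1 hp hp' hf)
  simpa [Fintype.card_fin] using h

/-- At most `4d²` plaquette labels through any link. [folklore] -/
theorem card_through_le (e : Edge d L) :
    (Finset.univ.filter fun p : Site d L × Fin d × Fin d => e ∈ plaqLinks d L p).card ≤ 4 * (d * d) := by
  have hsub : (Finset.univ.filter fun p : Site d L × Fin d × Fin d => e ∈ plaqLinks d L p)
      ⊆ (Finset.univ : Finset (Fin 4)).biUnion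
        (fun s => Finset.univ.filter fun p : Site d L × Fin d × Fin d => plaqIdx p.1 p.2.1 p.2.2 s = e) := by
    intro p hp
    simp only [Finset.mem_filter, Finset.mem_univ, true_and, mem_plaqLinks] at hp
    obtain ⟨s, hs⟩ := hp
    simp only [Finset.mem_biUnion, Finset.mem_univ, true_and, Finset.mem_filter]
    exact ⟨s, hs⟩
  refine (Finset.card_le_card hsub).trans (Finset.card_biUnion_le.trans ?_)
  calc ∑ s : Fin 4, (Finset.univ.filter
          fun p : Site d L × Fin d × Fin d => plaqIdx p.1 p.2.1 p.2.2 s = e).card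
      ≤ ∑ _s : Fin 4, d * d := Finset.sum_le_sum fun s _ => card_filter_slot_le e s
    _ = 4 * (d * d) := by simp

variable (d L)

/-- **The plaquette link complex** of the periodic lattice `(ℤ/L)^d`, with `D = 4d²`. [folklore] -/
def plaqComplex : LinkComplex (Edge d L) (Site d L × Fin d × Fin d) where
  plaqs := Finset.univ
  links := plaqLinks d L
  card_links_le := card_plaqLinks_le
  D := 4 * (d * d)
  card_through_le := card_through_le

end Complex

end Summit.Ventures.LatticeQCDFlow.TrivializingMaps.GradedSeries
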